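import Summits.BirchSwinnertonDyer.Rank1Residual.X10.SelfTwistVisibleGoodAtThree
import HarnessLib

/-!
# N2 (X10b @ 3): SELF-TWIST visibility records with the place `3` FREE (kind (v), Mazur–Rubin 2015) —
# `395641f1` (twin `395641g1`, `d* = 37`) and `40898d1` (twin `40898e1`, `d* = −143`, place `2` of kind (iii))
# (cell `b2b-bsdres`, unit `b2b-bsdres-x10` = N2 class lead, GEN 22; per-pair RECORDS, close nothing)

HONEST FRAMING (cell `b2b-bsdres`, run/shared/lean/b2b/bsd-rank1-residual/, verbatim in every
file): the goal of the cell is to DELETE the COMBINATION-SHAPED residual classes of the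
Birch–Swinnerton-Dyer formula for ALL analytic-rank `≤ 1` elliptic curves over `ℚ` — "full BSD
formula for every rank `≤ 1` curve in class `C`" assembled STRICTLY from published theorems — so
that the rank-`≤ 1` remainder becomes exactly the CONSTRUCTION-SHAPED classes, which are TYPED
(missing-input `Prop`s), NOT attempted. This is not "finishing BSD". Class X10b (= N2) stays
CONSTRUCTION-SHAPED (NEEDS `X_A3`); this file holds PER-PAIR RECORDS of the LOWER half only; nothing is
booked; no mark / label / tier / count is changed. Theorems only (no definition, no named fact of ours,
no `sorry`).

## What

Continuation of `X10/SelfTwistVisibleGoodAtThree.lean` (x10 GEN 22; socket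
`exists_sha_ne_zero_three_of_congr_goodAtThree[_mult]_of_primeList`): the N2 self-twist visibility road
(x10 GEN 21 `SELF-TWIST-LAW.md`, `class-closure/N2/KIND-VIII-SPEC-x10g21.md`) for the rank-`0` Ш-cells whose
rank-2 twin is ANOMALOUS at `3` (`#E′(ℚ₃)[3] = 3`, PAY3 = 9 = 3², no budget), with the place `3` FREE of
kind (v): Mazur–Rubin, *Selmer companion curves*, Trans. AMS 367 (2015) Thm. 3.1 (iv)(b) / §6 Case 5 — the
tree's NAMED FACT `selmerLocalKer_iff_of_goodReduction_above` (x10b GEN 15), binder `hMR` DISPLAYED.  Per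
record: `∃ c ∈ Ш(E), c ≠ 0, 3c = 0`; `3² ∣ #Ш(E)[3^∞]` (`hCT`); the typed LOWER binder
`MissingLowerBoundAt W 3` (`hq`).  Every local binder IN THE KERNEL: TamLocal certificates (n1011-p18's glue
`g11/tools/vis3_certs.py` UNCHANGED, observatory Tate engine), the twin's global minimality (x11c's Kraus
criterion / x10 GEN 18's pattern F2d), `E[3]` irreducible from a Frobenius witness over x10 GEN 12's landed
point counts.  BINDERS LEFT (displayed, EVIDENCE columns — nothing booked): `hMR`, `hCT`, `hGZK`,
`hr : r_an(E) = 0` (Cremona), `θ : E′[3] ≃ E[3]` with `hθ` (the self-twist congruence `ρ̄ ⊗ χ_{d*} ≅ ρ̄` of the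
`3Ns` image; EVIDENCE: cc-eng-2 KO-certified `class-closure/N2/CONG-certified-eng2.tsv`, kit j123296, rows
quoted per record), `hrank : 1 ≤ rank E′(ℚ)` (Cremona: rank `2`, generators quoted), `hq` (`#Ш_an`).
Rows here: `395641f1` (`N = 17²·37²`, `2` GOOD, `#Ш_an = 36`; KO row 395641f/395641g, bound 71 705, 7 095
primes; twin generators `(1250620/25, 111062782/125)`, `(−843850/49, 345612/343)`; witness `ℓ = 13`, `#Ẽ = 20`
with a NEW kernel point count `card_t395641f1_13` — this row was not among x10 GEN 12's fourteen CTP counts;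
twin additive at `17` (`I*ₙ`, `{2,4}`) and `37` (type `III`, `c = 2`)) and `40898d1` (`N = 2·11²·13²`; KO row
40898d/40898e, bound 12 011, 1 437 primes; twin generators `(10, 0)`, `(−12, 77)`; witness `ℓ = 31`, `#Ẽ = 32`;
twin additive at `11`, `13` (type `III`, `c = 2`) and BOTH curves non-split multiplicative at `2` with
`γ(E)/γ(E′) = −1/143 ∈ (ℚ₂ˣ)²` (`−143 ≡ 1 (8)`), `μ₃(ℚ₂) = 1`: kind (iii) through the socket
`…_goodAtThree_mult_of_primeList`, CONDITIONAL in addition on the Tate-uniformisation named fact `hU2`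
(Silverman ATAEC V.5.3 / Cor. V.5.4; p17's `sqFlagAt` numerals)).

References: [MazurRubin2015SelmerCompanions] Thm. 3.1 (iv)(b), §5.3, §6 Case 5; [CremonaMazur2000] §3;
[AgasheStein2002] Thm. 3.1; [Mazur1978] Prop. 6.3 (1); [SilvermanATAEC1994] IV.9.4, V.5.3–5.4;
[SilvermanAEC2009] VII.5.1, X.4.14; [Kraus1989] Prop. 2; [Cremona2006] Table 1.
-/

set_option autoImplicit false

noncomputable section

open scoped Classical NumberField
open IsDedekindDomain NumberField WeierstrassCurve Rat.HeightOneSpectrum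
  Literature.NumberTheory.EllipticCurves Literature.NumberTheory.EllipticCurves.ModularForms
  Literature.NumberTheory.EllipticCurves.Rank1Residual
  Literature.NumberTheory.EllipticCurves.Rank1Residual.Typed
  Literature.NumberTheory.EllipticCurves.MazurRubin2015
  Literature.NumberTheory.GaloisRepresentations
  Summit.BirchSwinnertonDyer.BirchSwinnertonDyer.Rank1Residual.IntModel
  Summit.BirchSwinnertonDyer.BirchSwinnertonDyer.Rank1Residual.X11RankOne
  Summit.BirchSwinnertonDyer.BirchSwinnertonDyer.Rank2Observatory
  Summit.BirchSwinnertonDyer.BirchSwinnertonDyer.Rank2Observatory.Tam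
  Summit.BirchSwinnertonDyer.Rank1Residual.GaloisImage
  Summit.BirchSwinnertonDyer.Rank1Residual.GaloisImage.LocalTorsion3At
  Summit.BirchSwinnertonDyer.Rank1Residual.Additive
  Summit.BirchSwinnertonDyer.Rank1Residual.X11b

namespace Summit.BirchSwinnertonDyer.Rank1Residual.X10.SelfTwist

/-! ### Record `395641f1` (twin `395641g1`; `N = 395641 = 17²·37²`, `d* = 37`, `#Ш_an(E) = 36`) -/
/-- `#Ẽ(𝔽_{13}) = 20` (`a_{13} = -6`; `X² + 6X + 13` is root-free mod `3`) for Cremona's model `395641f1` (kernel count; x10 GEN 12's shape). [folklore] -/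
theorem card_t395641f1_13 :
    Nat.card (((⟨0, 1, 1, (-24934614623), (-1515437094749663)⟩ : WeierstrassCurve ℤ).map (Int.castRingHom (ZMod 13))).toAffine.Point) = 20 := by
  rw [@WeierstrassCurve.natCard_point_eq_one_add_card (ZMod 13) (@ZMod.instField 13 ⟨by norm_num⟩) _ _ _
    (by decide +kernel), @card_sol_eq_sum_euler (ZMod 13) (@ZMod.instField 13 ⟨by norm_num⟩) _ _
    (by rw [ZMod.ringChar_zmod_n]; decide), ZMod.card]
  decide +kernel

/-- The Frobenius polynomial at `13` of a curve with `#Ẽ(𝔽_{13}) = 20` reduced mod `3`, `X² − (13 + 1 − 20)X + 13`, has no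
root in `𝔽₃` (irreducibility witness numeral, x10 GEN 12's shape). [folklore] -/
theorem noroot3_frob_13_20 :
    ∀ t : ZMod 3, t ^ 2 - ((((13 : ℕ) : ℤ) + 1 - (20 : ℕ) : ℤ) : ZMod 3) * t + ((13 : ℕ) : ZMod 3) ≠ 0 := by
  decide

/-- The local Tamagawa certificate of the self-twist `395641g1` at `17` (`TamLocal` = `⟨17, 4, 5, 0, 40896, 0, 709928, 12, 72, 2, 4⟩`, additive Kodaira `I*ₙ`, value set `{2,4}`) passes
the kernel check (n1011-p18's glue `vis3_certs.py`, observatory Tate engine, unchanged). [cite: SilvermanATAEC1994, IV.9.4] -/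
theorem tamLocal_check_395641g1_17 :
    TamLocal.check ⟨17, 4, 5, 0, 40896, 0, 709928, 12, 72, 2, 4⟩ ⟨0, 1, 1, (-18213743), (-29923919810)⟩ = true := by
  decide +kernel

/-- The local Tamagawa certificate of the self-twist `395641g1` at `37` (`TamLocal` = `⟨37, 6, 4, 0, 12, 0, 18, 3, 3, 2, 2⟩`, additive type `III`, `c = 2`) passes
the kernel check (n1011-p18's glue `vis3_certs.py`, observatory Tate engine, unchanged). [cite: SilvermanATAEC1994, IV.9.4] -/
theorem tamLocal_check_395641g1_37 :
    TamLocal.check ⟨37, 6, 4, 0, 12, 0, 18, 3, 3, 2, 2⟩ ⟨0, 1, 1, (-18213743), (-29923919810)⟩ = true := by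
  decide +kernel

/-- **SELF-TWIST VISIBILITY RECORD, place `3` FREE (closes nothing, moves no mark): a non-zero `3`-torsion
element of `Ш(E/ℚ)` for `E = 395641f1` from its rank-2 self-twist `E′ = 395641g1 = E ⊗ χ_{37}`**, both curves
GOOD ORDINARY and ANOMALOUS at `3` (kind (v), `hMR`); the other places of `S` = places over `[3, 17, 37]` are additive for
`E′` with `E′(ℚ_ℓ)[3] = 0` (kind (i), TamLocal certificates in the kernel: `17` (Kodaira I*ₙ, value set {2,4}), `37` (type III, c = 2)); `E[3]` irreducible from
the Frobenius witness `ℓ = 13` (`#Ẽ(𝔽_{13}) = 20`). Conditional on `hMR` (Mazur–Rubin 2015).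
[cite: MazurRubin2015SelmerCompanions, Thm. 3.1 (iv)(b) and §6 proof Case 5] [cite: CremonaMazur2000, §3 and Table 1]
[cite: Mazur1978, §6 Prop. 6.3 (1) (p. 153)] [cite: Cremona2006, Table 1 (labels 395641f1, 395641g1)] -/
theorem exists_sha_three_selfTwist_v395641f1
    (hMR : selmerLocalKer_iff_of_goodReduction_above)
    (hGZK : rank_eq_analyticRank_of_analyticRank_le_one)
    (W : WeierstrassCurve ℚ) [W.IsElliptic] [W.IsGloballyMinimal]
    (hI : integralModelInt W = ⟨0, 1, 1, (-24934614623), (-1515437094749663)⟩) (hr : W.analyticRank = 0)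
    (W' : WeierstrassCurve ℚ) (hW' : W' = ⟨0, 1, 1, (-18213743), (-29923919810)⟩) [W'.IsElliptic]
    (θ : geomTorsion W' ((3 : ℕ) : ℤ) ≃+ geomTorsion W ((3 : ℕ) : ℤ))
    (hθ : ∀ (σ : Field.absoluteGaloisGroup ℚ) (P : geomTorsion W' ((3 : ℕ) : ℤ)), θ (σ • P) = σ • θ P)
    (hrank : 1 ≤ W'.mordellWeilRank) :
    ∃ c : W.sha, c ≠ 0 ∧ 3 • c = 0 := by
  haveI : Fact (Nat.Prime 3) := ⟨Nat.prime_three⟩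
  haveI : Fact (Nat.Prime 13) := ⟨by norm_num⟩
  haveI : Fact (Nat.Prime 17) := ⟨by norm_num⟩
  haveI : Fact (Nat.Prime 37) := ⟨by norm_num⟩
  -- the row `395641f1`: `E(ℚ)` finite of order prime to `3`
  have hfin : Finite W.toAffine.Point := finite_point_of_analyticRank_eq_zero W hGZK hr
  have hirr : W.HasIrreducibleModPGaloisRep 3 :=
    hasIrreducibleModPGaloisRep_of_intModel_of_noroot hI 3 13 (by norm_num) (by decide +kernel)
      card_t395641f1_13 noroot3_frob_13_20
  have hcop : (Nat.card W.toAffine.Point).Coprime 3 := coprime_natCard_point_of_irr W 3 hirr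
  have hE : (⟨0, 1, 1, (-24934614623), (-1515437094749663)⟩ : WeierstrassCurve ℤ).map (Int.castRingHom ℚ) = W := by
    rw [IntModelTam.eq_baseChange_of_integralModelInt hI]; rfl
  -- the partner `395641g1`: globally minimal, integral model
  have hM' : W'.IsGloballyMinimal := by
    rw [hW']
    exact isGloballyMinimal_of_krausCriterion_bounded₂ 0 1 1 (-18213743) (-29923919810)
      (by decide +kernel) (by decide +kernel) (by decide +kernel)
  have hI' : integralModelInt W' = ⟨0, 1, 1, (-18213743), (-29923919810)⟩ := by
    subst hW'; exact integralModelInt_eq_of_map_eq _ (map_mk_int 0 1 1 (-18213743) (-29923919810))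
  have hF : (⟨0, 1, 1, (-18213743), (-29923919810)⟩ : WeierstrassCurve ℤ).map (Int.castRingHom ℚ) = W' := by
    rw [hW']; exact map_mk_int 0 1 1 (-18213743) (-29923919810)
  -- prime support of the two discriminants
  have hΔE : ∀ q : ℕ, q.Prime → (q : ℤ) ∣ (⟨0, 1, 1, (-24934614623), (-1515437094749663)⟩ : WeierstrassCurve ℤ).Δ → q ∈ [3, 17, 37] :=
    X11b.forall_mem_of_natAbs_eq_prod_pow [3, 17, 37] [0, 12, 9]
      (by intro q hq; simp only [List.mem_cons, List.mem_nil_iff, or_false] at hq; rcases hq with rfl | rfl | rfl <;> norm_num)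
      (by decide +kernel)
  have hΔF : ∀ q : ℕ, q.Prime → (q : ℤ) ∣ (⟨0, 1, 1, (-18213743), (-29923919810)⟩ : WeierstrassCurve ℤ).Δ → q ∈ [3, 17, 37] :=
    X11b.forall_mem_of_natAbs_eq_prod_pow [3, 17, 37] [0, 12, 3]
      (by intro q hq; simp only [List.mem_cons, List.mem_nil_iff, or_false] at hq; rcases hq with rfl | rfl | rfl <;> norm_num)
      (by decide +kernel)
  refine exists_sha_ne_zero_three_of_congr_goodAtThree_of_primeList hMR W W' θ hθ hE hF [3, 17, 37] (by simp) hΔE hΔF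
    (by decide +kernel) (by decide +kernel) hfin hcop hrank (fun v hvL hv3 ↦ ?_)
  simp only [List.mem_cons, List.mem_nil_iff, or_false] at hvL
  rcases hvL with h3 | h17 | h37
  · exact absurd h3 hv3
  · -- `v = 17`: additive Kodaira I*ₙ, value set {2,4}
    exact LocalTorsionAway.natCard_ker_nsmul_adicCompletion_eq_one_of_intModel_of_additive_tamLocal_forall hI' 17 3
      (by norm_num) h17 (by decide) (by decide) (E := ⟨17, 4, 5, 0, 40896, 0, 709928, 12, 72, 2, 4⟩) rfl
      tamLocal_check_395641g1_17 (by decide)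
  · -- `v = 37`: additive type III, `c = 2`
    exact LocalTorsionAway.natCard_ker_nsmul_adicCompletion_eq_one_of_intModel_of_additive hI' 37 3 (by norm_num) h37
      (by decide) (by decide)
      (IntModelTam.localTamagawaNumber_padic_eq_of_intModel_of_tamLocal hI' 37 (E := ⟨37, 6, 4, 0, 12, 0, 18, 3, 3, 2, 2⟩)
        rfl tamLocal_check_395641g1_37 (c := 2) (by decide)) (by norm_num)

/-- **`3² ∣ #Ш(395641f1)[3^∞]`** from the visible element and the Cassels–Tate parity (`hCT`). Conditional on `hMR`, `hCT`.
[cite: SilvermanAEC2009, Thm. X.4.14] [cite: MazurRubin2015SelmerCompanions, Thm. 3.1 (iv)(b)] -/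
theorem sq_dvd_card_sha_three_selfTwist_v395641f1
    (hCT : exists_casselsTate_pairing (K := ℚ))
    (hMR : selmerLocalKer_iff_of_goodReduction_above)
    (hGZK : rank_eq_analyticRank_of_analyticRank_le_one)
    (W : WeierstrassCurve ℚ) [W.IsElliptic] [W.IsGloballyMinimal]
    (hI : integralModelInt W = ⟨0, 1, 1, (-24934614623), (-1515437094749663)⟩) (hr : W.analyticRank = 0)
    (W' : WeierstrassCurve ℚ) (hW' : W' = ⟨0, 1, 1, (-18213743), (-29923919810)⟩) [W'.IsElliptic]
    (θ : geomTorsion W' ((3 : ℕ) : ℤ) ≃+ geomTorsion W ((3 : ℕ) : ℤ))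
    (hθ : ∀ (σ : Field.absoluteGaloisGroup ℚ) (P : geomTorsion W' ((3 : ℕ) : ℤ)), θ (σ • P) = σ • θ P)
    (hrank : 1 ≤ W'.mordellWeilRank) :
    3 ^ 2 ∣ Nat.card (AddCommGroup.primaryComponent W.sha 3) := by
  haveI : Finite W.sha := (hGZK W (by rw [hr]; exact zero_le_one)).2
  exact Visible.sq_dvd_card_sha_three_of_exists_sha_torsion hCT W
    (exists_sha_three_selfTwist_v395641f1 hMR hGZK W hI hr W' hW' θ hθ hrank)

/-- **The typed LOWER binder `MissingLowerBoundAt E 3` for `395641f1`** (`ord₃ #Ш_an ≤ ord₃ #Ш`) from the visible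
`3`-torsion element, the Cassels–Tate squareness and the analytic datum `#Ш_an = 36` (`hq`, Cremona `allbsd`;
evidence binder). Conditional on `hMR`, `hCT`. [cite: SilvermanAEC2009, Thm. X.4.14] [cite: Cremona2006, Table 1 (label 395641f1)] -/
theorem missingLowerBoundAt_three_selfTwist_v395641f1
    (hCT : exists_casselsTate_pairing (K := ℚ))
    (hMR : selmerLocalKer_iff_of_goodReduction_above)
    (hGZK : rank_eq_analyticRank_of_analyticRank_le_one)
    (W : WeierstrassCurve ℚ) [W.IsElliptic] [W.IsGloballyMinimal]
    (hI : integralModelInt W = ⟨0, 1, 1, (-24934614623), (-1515437094749663)⟩) (hr : W.analyticRank = 0)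
    {q : ℚ} (hq : shaAn W = (q : ℂ)) (hv : padicValRat 3 q ≤ 2)
    (W' : WeierstrassCurve ℚ) (hW' : W' = ⟨0, 1, 1, (-18213743), (-29923919810)⟩) [W'.IsElliptic]
    (θ : geomTorsion W' ((3 : ℕ) : ℤ) ≃+ geomTorsion W ((3 : ℕ) : ℤ))
    (hθ : ∀ (σ : Field.absoluteGaloisGroup ℚ) (P : geomTorsion W' ((3 : ℕ) : ℤ)), θ (σ • P) = σ • θ P)
    (hrank : 1 ≤ W'.mordellWeilRank) :
    haveI : Fact (Nat.Prime 3) := ⟨Nat.prime_three⟩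
    MissingLowerBoundAt W 3 := by
  haveI : Fact (Nat.Prime 3) := ⟨Nat.prime_three⟩
  have hvis := exists_sha_three_selfTwist_v395641f1 hMR hGZK W hI hr W' hW' θ hθ hrank
  exact missingLowerBoundAt_of_casselsTate_of_pow_dvd W 3 hCT (hGZK W (by rw [hr]; exact zero_le_one)).2 hq
    (k := 1) (by simpa using hv) (by simpa using dvd_shaOrder_of_exists_torsion W 3 hvis)

/-! ### Record `40898d1` (twin `40898e1`; `N = 40898 = 2·11²·13²`, `d* = -143`, `#Ш_an(E) = 9`) -/
/-- The Frobenius polynomial at `31` of a curve with `#Ẽ(𝔽_{31}) = 32` reduced mod `3`, `X² − (31 + 1 − 32)X + 31`, has no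
root in `𝔽₃` (irreducibility witness numeral, x10 GEN 12's shape). [folklore] -/
theorem noroot3_frob_31_32 :
    ∀ t : ZMod 3, t ^ 2 - ((((31 : ℕ) : ℤ) + 1 - (32 : ℕ) : ℤ) : ZMod 3) * t + ((31 : ℕ) : ZMod 3) ≠ 0 := by
  decide

/-- The local Tamagawa certificate of the self-twist `40898e1` at `11` (`TamLocal` = `⟨11, 3, 4, 0, 10, 0, 0, 3, 3, 2, 2⟩`, additive type `III`, `c = 2`) passes
the kernel check (n1011-p18's glue `vis3_certs.py`, observatory Tate engine, unchanged). [cite: SilvermanATAEC1994, IV.9.4] -/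
theorem tamLocal_check_40898e1_11 :
    TamLocal.check ⟨11, 3, 4, 0, 10, 0, 0, 3, 3, 2, 2⟩ ⟨1, 0, 1, (-355), 2550⟩ = true := by
  decide +kernel

/-- The local Tamagawa certificate of the self-twist `40898e1` at `13` (`TamLocal` = `⟨13, 3, 4, 0, 1, 0, 12, 3, 3, 2, 2⟩`, additive type `III`, `c = 2`) passes
the kernel check (n1011-p18's glue `vis3_certs.py`, observatory Tate engine, unchanged). [cite: SilvermanATAEC1994, IV.9.4] -/
theorem tamLocal_check_40898e1_13 :
    TamLocal.check ⟨13, 3, 4, 0, 1, 0, 12, 3, 3, 2, 2⟩ ⟨1, 0, 1, (-355), 2550⟩ = true := by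
  decide +kernel

/-- **SELF-TWIST VISIBILITY RECORD, place `3` FREE (closes nothing, moves no mark): a non-zero `3`-torsion
element of `Ш(E/ℚ)` for `E = 40898d1` from its rank-2 self-twist `E′ = 40898e1 = E ⊗ χ_{-143}`**, both curves
GOOD ORDINARY and ANOMALOUS at `3` (kind (v), `hMR`); the other places of `S` = places over `[2, 3, 11, 13]` are the place `2` — BOTH curves non-split multiplicative, same twist class `γ(E)/γ(E′) = -1/143 ∈ (ℚ₂ˣ)²`, `μ₃(ℚ₂) = 1` (kind (iii), Tate uniformisation `hU2`) — and places additive for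
`E′` with `E′(ℚ_ℓ)[3] = 0` (kind (i), TamLocal certificates in the kernel: `11` (type III, c = 2), `13` (type III, c = 2)); `E[3]` irreducible from
the Frobenius witness `ℓ = 31` (`#Ẽ(𝔽_{31}) = 32`). Conditional on `hMR` (Mazur–Rubin 2015) and `hU2` (Silverman ATAEC V.5.3/5.4).
[cite: MazurRubin2015SelmerCompanions, Thm. 3.1 (iv)(b) and §6 proof Case 5] [cite: CremonaMazur2000, §3 and Table 1]
[cite: Mazur1978, §6 Prop. 6.3 (1) (p. 153)] [cite: Cremona2006, Table 1 (labels 40898d1, 40898e1)] -/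
theorem exists_sha_three_selfTwist_v40898d1
    (hU2 : Silverman1994_thmV53_corV54_tateUniformisation.{0})
    (hMR : selmerLocalKer_iff_of_goodReduction_above)
    (hGZK : rank_eq_analyticRank_of_analyticRank_le_one)
    (W : WeierstrassCurve ℚ) [W.IsElliptic] [W.IsGloballyMinimal]
    (hI : integralModelInt W = ⟨1, 0, 1, (-7249597), (-7544452368)⟩) (hr : W.analyticRank = 0)
    (W' : WeierstrassCurve ℚ) (hW' : W' = ⟨1, 0, 1, (-355), 2550⟩) [W'.IsElliptic]
    (θ : geomTorsion W' ((3 : ℕ) : ℤ) ≃+ geomTorsion W ((3 : ℕ) : ℤ))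
    (hθ : ∀ (σ : Field.absoluteGaloisGroup ℚ) (P : geomTorsion W' ((3 : ℕ) : ℤ)), θ (σ • P) = σ • θ P)
    (hrank : 1 ≤ W'.mordellWeilRank) :
    ∃ c : W.sha, c ≠ 0 ∧ 3 • c = 0 := by
  haveI : Fact (Nat.Prime 3) := ⟨Nat.prime_three⟩
  haveI : Fact (Nat.Prime 2) := ⟨by norm_num⟩
  haveI : Fact (Nat.Prime 11) := ⟨by norm_num⟩
  haveI : Fact (Nat.Prime 13) := ⟨by norm_num⟩
  haveI : Fact (Nat.Prime 31) := ⟨by norm_num⟩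
  -- the row `40898d1`: `E(ℚ)` finite of order prime to `3`
  have hfin : Finite W.toAffine.Point := finite_point_of_analyticRank_eq_zero W hGZK hr
  have hirr : W.HasIrreducibleModPGaloisRep 3 :=
    hasIrreducibleModPGaloisRep_of_intModel_of_noroot hI 3 31 (by norm_num) (by decide +kernel)
      Summit.BirchSwinnertonDyer.Rank1Residual.X10.card_t40898d1_31 noroot3_frob_31_32
  have hcop : (Nat.card W.toAffine.Point).Coprime 3 := coprime_natCard_point_of_irr W 3 hirr
  have hE : (⟨1, 0, 1, (-7249597), (-7544452368)⟩ : WeierstrassCurve ℤ).map (Int.castRingHom ℚ) = W := by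
    rw [IntModelTam.eq_baseChange_of_integralModelInt hI]; rfl
  have hWq : W = ⟨1, 0, 1, (-7249597), (-7544452368)⟩ := by
    rw [← hE]; exact map_mk_int 1 0 1 (-7249597) (-7544452368)
  -- the partner `40898e1`: globally minimal, integral model
  have hM' : W'.IsGloballyMinimal := by
    rw [hW']
    exact isGloballyMinimal_of_krausCriterion_bounded₂ 1 0 1 (-355) 2550
      (by decide +kernel) (by decide +kernel) (by decide +kernel)
  have hI' : integralModelInt W' = ⟨1, 0, 1, (-355), 2550⟩ := by
    subst hW'; exact integralModelInt_eq_of_map_eq _ (map_mk_int 1 0 1 (-355) 2550)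
  have hF : (⟨1, 0, 1, (-355), 2550⟩ : WeierstrassCurve ℤ).map (Int.castRingHom ℚ) = W' := by
    rw [hW']; exact map_mk_int 1 0 1 (-355) 2550
  -- prime support of the two discriminants
  have hΔE : ∀ q : ℕ, q.Prime → (q : ℤ) ∣ (⟨1, 0, 1, (-7249597), (-7544452368)⟩ : WeierstrassCurve ℤ).Δ → q ∈ [2, 3, 11, 13] :=
    X11b.forall_mem_of_natAbs_eq_prod_pow [2, 3, 11, 13] [3, 0, 9, 9]
      (by intro q hq; simp only [List.mem_cons, List.mem_nil_iff, or_false] at hq; rcases hq with rfl | rfl | rfl | rfl <;> norm_num)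
      (by decide +kernel)
  have hΔF : ∀ q : ℕ, q.Prime → (q : ℤ) ∣ (⟨1, 0, 1, (-355), 2550⟩ : WeierstrassCurve ℤ).Δ → q ∈ [2, 3, 11, 13] :=
    X11b.forall_mem_of_natAbs_eq_prod_pow [2, 3, 11, 13] [3, 0, 3, 3]
      (by intro q hq; simp only [List.mem_cons, List.mem_nil_iff, or_false] at hq; rcases hq with rfl | rfl | rfl | rfl <;> norm_num)
      (by decide +kernel)
  refine exists_sha_ne_zero_three_of_congr_goodAtThree_mult_of_primeList hU2 hMR W W' θ hθ hE hF [2, 3, 11, 13] (by simp)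
    hΔE hΔF
    (by decide +kernel) (by decide +kernel) hfin hcop hrank (fun v hvL hv3 ↦ ?_)
  simp only [List.mem_cons, List.mem_nil_iff, or_false] at hvL
  rcases hvL with h2 | h3 | h11 | h13
  · -- `v = 2`: both curves multiplicative, same twist class `γ(E)/γ(E′) = -1/143 ∈ (ℚ₂ˣ)²`, `μ₃(ℚ₂) = 1` (kind (iii))
    refine Or.inr ⟨?_, ?_, ?_, ?_⟩
    · refine W.hasMultiplicativeReductionAt_of_dvd_of_not_dvd v ?_ ?_
      · rw [h2, minimalDiscriminantInt_eq hI]; decide +kernel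
      · rw [h2, hI]; decide +kernel
    · haveI := hM'
      refine W'.hasMultiplicativeReductionAt_of_dvd_of_not_dvd v ?_ ?_
      · rw [h2, minimalDiscriminantInt_eq hI']; decide +kernel
      · rw [h2, hI']; decide +kernel
    · refine exists_eq_sq_mul_of_sqFlagAt v h2 (N := -1) (D := 143) ?_ (by norm_num) ?_ (w := 0)
        (by norm_num) (by norm_num) (by decide +kernel)
      · rw [hW']
        norm_num [WeierstrassCurve.c₄, WeierstrassCurve.c₆, WeierstrassCurve.b₂, WeierstrassCurve.b₄,
          WeierstrassCurve.b₆]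
      · rw [hWq, hW']
        norm_num [WeierstrassCurve.c₄, WeierstrassCurve.c₆, WeierstrassCurve.b₂, WeierstrassCurve.b₄,
          WeierstrassCurve.b₆]
    · exact forall_pow_three_eq_one_adicCompletion_of_sqFlagAt v h2 (w₃ := 0) (by norm_num) (by norm_num)
        (by decide +kernel)
  · exact absurd h3 hv3
  · -- `v = 11`: additive type III, `c = 2`
    exact Or.inl <| LocalTorsionAway.natCard_ker_nsmul_adicCompletion_eq_one_of_intModel_of_additive hI' 11 3 (by norm_num) h11
      (by decide) (by decide)
      (IntModelTam.localTamagawaNumber_padic_eq_of_intModel_of_tamLocal hI' 11 (E := ⟨11, 3, 4, 0, 10, 0, 0, 3, 3, 2, 2⟩)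
        rfl tamLocal_check_40898e1_11 (c := 2) (by decide)) (by norm_num)
  · -- `v = 13`: additive type III, `c = 2`
    exact Or.inl <| LocalTorsionAway.natCard_ker_nsmul_adicCompletion_eq_one_of_intModel_of_additive hI' 13 3 (by norm_num) h13
      (by decide) (by decide)
      (IntModelTam.localTamagawaNumber_padic_eq_of_intModel_of_tamLocal hI' 13 (E := ⟨13, 3, 4, 0, 1, 0, 12, 3, 3, 2, 2⟩)
        rfl tamLocal_check_40898e1_13 (c := 2) (by decide)) (by norm_num)

/-- **`3² ∣ #Ш(40898d1)[3^∞]`** from the visible element and the Cassels–Tate parity (`hCT`). Conditional on `hMR`, `hCT`.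
[cite: SilvermanAEC2009, Thm. X.4.14] [cite: MazurRubin2015SelmerCompanions, Thm. 3.1 (iv)(b)] -/
theorem sq_dvd_card_sha_three_selfTwist_v40898d1
    (hCT : exists_casselsTate_pairing (K := ℚ))
    (hU2 : Silverman1994_thmV53_corV54_tateUniformisation.{0})
    (hMR : selmerLocalKer_iff_of_goodReduction_above)
    (hGZK : rank_eq_analyticRank_of_analyticRank_le_one)
    (W : WeierstrassCurve ℚ) [W.IsElliptic] [W.IsGloballyMinimal]
    (hI : integralModelInt W = ⟨1, 0, 1, (-7249597), (-7544452368)⟩) (hr : W.analyticRank = 0)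
    (W' : WeierstrassCurve ℚ) (hW' : W' = ⟨1, 0, 1, (-355), 2550⟩) [W'.IsElliptic]
    (θ : geomTorsion W' ((3 : ℕ) : ℤ) ≃+ geomTorsion W ((3 : ℕ) : ℤ))
    (hθ : ∀ (σ : Field.absoluteGaloisGroup ℚ) (P : geomTorsion W' ((3 : ℕ) : ℤ)), θ (σ • P) = σ • θ P)
    (hrank : 1 ≤ W'.mordellWeilRank) :
    3 ^ 2 ∣ Nat.card (AddCommGroup.primaryComponent W.sha 3) := by
  haveI : Finite W.sha := (hGZK W (by rw [hr]; exact zero_le_one)).2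
  exact Visible.sq_dvd_card_sha_three_of_exists_sha_torsion hCT W
    (exists_sha_three_selfTwist_v40898d1 hU2 hMR hGZK W hI hr W' hW' θ hθ hrank)

/-- **The typed LOWER binder `MissingLowerBoundAt E 3` for `40898d1`** (`ord₃ #Ш_an ≤ ord₃ #Ш`) from the visible
`3`-torsion element, the Cassels–Tate squareness and the analytic datum `#Ш_an = 9` (`hq`, Cremona `allbsd`;
evidence binder). Conditional on `hMR`, `hCT`. [cite: SilvermanAEC2009, Thm. X.4.14] [cite: Cremona2006, Table 1 (label 40898d1)] -/
theorem missingLowerBoundAt_three_selfTwist_v40898d1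
    (hCT : exists_casselsTate_pairing (K := ℚ))
    (hU2 : Silverman1994_thmV53_corV54_tateUniformisation.{0})
    (hMR : selmerLocalKer_iff_of_goodReduction_above)
    (hGZK : rank_eq_analyticRank_of_analyticRank_le_one)
    (W : WeierstrassCurve ℚ) [W.IsElliptic] [W.IsGloballyMinimal]
    (hI : integralModelInt W = ⟨1, 0, 1, (-7249597), (-7544452368)⟩) (hr : W.analyticRank = 0)
    {q : ℚ} (hq : shaAn W = (q : ℂ)) (hv : padicValRat 3 q ≤ 2)
    (W' : WeierstrassCurve ℚ) (hW' : W' = ⟨1, 0, 1, (-355), 2550⟩) [W'.IsElliptic]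
    (θ : geomTorsion W' ((3 : ℕ) : ℤ) ≃+ geomTorsion W ((3 : ℕ) : ℤ))
    (hθ : ∀ (σ : Field.absoluteGaloisGroup ℚ) (P : geomTorsion W' ((3 : ℕ) : ℤ)), θ (σ • P) = σ • θ P)
    (hrank : 1 ≤ W'.mordellWeilRank) :
    haveI : Fact (Nat.Prime 3) := ⟨Nat.prime_three⟩
    MissingLowerBoundAt W 3 := by
  haveI : Fact (Nat.Prime 3) := ⟨Nat.prime_three⟩
  have hvis := exists_sha_three_selfTwist_v40898d1 hU2 hMR hGZK W hI hr W' hW' θ hθ hrank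
  exact missingLowerBoundAt_of_casselsTate_of_pow_dvd W 3 hCT (hGZK W (by rw [hr]; exact zero_le_one)).2 hq
    (k := 1) (by simpa using hv) (by simpa using dvd_shaOrder_of_exists_torsion W 3 hvis)


end Summit.BirchSwinnertonDyer.Rank1Residual.X10.SelfTwist

end
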